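import Summits.SmoothPoincare4.SmoothPoincare4.Theorems.SoloInformedBinaryIcosahedralOrderCert1
import Summits.SmoothPoincare4.SmoothPoincare4.Theorems.SoloInformedBinaryIcosahedral

/-!
# The binary icosahedral presentation `⟨x, y, z | x² = y³ = z⁵ = xyz⟩` defines a group of order 120

`Literature.Algebra.Homology.RelationModule` presents `⟨2,3,5⟩ = PresentedGroup (binaryTriangleRels 2 3 5)`
and proves (Brown, *Cohomology of Groups*, II §5 Exercise 7) that it is perfect, that `c = xyz` is central and
non-trivial with `2 ∣ orderOf c`, and constructs `icoHom : ⟨2,3,5⟩ →* SL(2, 𝔽₅)`.  What it does not prove is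
that the presentation is *finite*: `|⟨2,3,5⟩| = 120`, i.e. that `icoHom` is an isomorphism and `orderOf c = 2`
("Determine the order of `C`").  This file supplies exactly that, by a kernel-checked **coset enumeration**:
a proof-logging Todd–Coxeter run over `H = ⟨z⟩` (index `12`, and the logged `H`-relations give `z¹⁰ = 1`) is
replayed as a list of one-line inferences in the format of `SoloInformedCosetEnumeration`
(`F z S g k T` = "coset operator `S` times generator `g` equals `zᵏ` times coset operator `T`").
Consequences: `Nat.card ⟨2,3,5⟩ = 120`, `icoHom` is bijective, `⟨2,3,5⟩ ≃* SL(2, 𝔽₅)`, `orderOf c = 2`.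

This is input (L2) of the solo programme `solo-SmoothPoincare4-informed` (certified presentations of the
binary icosahedral group, used for the `P(-2,3,7)` surgery certificates); the certificate (the imported part files
`SoloInformedBinaryIcosahedralOrderCert*`: 66 coset operators, 98 one-line inferences of which 55 relator scans,
the 12-row coset table) is machine-generated (`work/s110/tc3.py` + `emit.py`) and checked by the kernel only —
no `native_decide`, no `decide` on the group.
-/

namespace Summit.SmoothPoincare4.SmoothPoincare4.Theorems
namespace BinaryIcosahedralOrder

open CosetEnum Literature.Algebra.Homology.RelationModule

/-! ### Consequences: `⟨2,3,5⟩ ≅ SL(2, 𝔽₅)` -/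
/-- `icoHom x = X`. -/
theorem icoHom_x : icoHom x = icoX := by
  rw [x, icoHom, PresentedGroup.toGroup.of]; rfl
/-- `icoHom z = Z`. -/
theorem icoHom_z : icoHom z = icoZ := by
  rw [z, icoHom, PresentedGroup.toGroup.of]; rfl
/-- `icoHom` is onto: its image contains the generating pair `x = X³`, `y = X³Z` of
`BinaryIcosahedral.closure_xy_eq_top`. -/
theorem icoHom_surjective : Function.Surjective icoHom := by
  rw [← MonoidHom.range_eq_top]
  apply BinaryIcosahedral.eq_top_of_mem
  · refine ⟨x * x * x, ?_⟩
    rw [map_mul, map_mul, icoHom_x]; decide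
  · refine ⟨x * x * x * z, ?_⟩
    rw [map_mul, map_mul, map_mul, icoHom_x, icoHom_z]; decide
/-- `|SL(2, 𝔽₅)| = 120` as a `Nat.card`. -/
theorem natCard_SL : Nat.card (Matrix.SpecialLinearGroup (Fin 2) (ZMod 5)) = 120 := by
  rw [Nat.card_eq_fintype_card, BinaryIcosahedral.card_eq]
/-- **`icoHom : ⟨2,3,5⟩ → SL(2, 𝔽₅)` is an isomorphism.** -/
theorem icoHom_bijective : Function.Bijective icoHom := by
  haveI : Finite G := finite
  exact icoHom_surjective.bijective_of_nat_card_le (by rw [natCard_SL]; exact card_le)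
/-- **`|⟨x, y, z | x² = y³ = z⁵ = xyz⟩| = 120`.** -/
theorem natCard_eq : Nat.card (PresentedGroup (binaryTriangleRels 2 3 5)) = 120 := by
  rw [Nat.card_congr (Equiv.ofBijective _ icoHom_bijective), natCard_SL]
/-- **`⟨2,3,5⟩ ≃* SL(2, 𝔽₅)`.** -/
noncomputable def mulEquivSL : PresentedGroup (binaryTriangleRels 2 3 5) ≃* Matrix.SpecialLinearGroup (Fin 2) (ZMod 5) :=
  MulEquiv.ofBijective icoHom icoHom_bijective
/-- **The central element `c = xyz` has order exactly `2`** (Brown II §5 Ex. 7(c): "Determine the order of `C`"). -/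
theorem orderOf_triCentral : orderOf (triCentral 2 3 5) = 2 := by
  haveI : Fact (Nat.Prime 2) := ⟨Nat.prime_two⟩
  refine orderOf_eq_prime ?_ triCentral_ne_one
  apply icoHom_bijective.1
  rw [map_pow, icoHom_triCentral, map_one]
  exact icoXYZ_sq
/-- The kernel of `⟨2,3,5⟩ → A₅`-type statement in the form used downstream: `⟨2,3,5⟩` is a finite perfect
group of order `120` with centre containing an element of order `2`. -/
theorem summary : Nat.card (PresentedGroup (binaryTriangleRels 2 3 5)) = 120 ∧
    Group.IsPerfect (PresentedGroup (binaryTriangleRels 2 3 5)) ∧ orderOf (triCentral 2 3 5) = 2 :=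
  ⟨natCard_eq, isPerfect_binaryIcosahedral, orderOf_triCentral⟩

end BinaryIcosahedralOrder
end Summit.SmoothPoincare4.SmoothPoincare4.Theorems
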